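import Summits.BirchSwinnertonDyer.BirchSwinnertonDyer.Theorems.EisensteinDepletionAtTwoStarOptBNSFStubTwoPowerWalk
import HarnessLib

/-!
# Line `star` on crux E1M (stmt-BirchSwinnertonDyer-20341): THE MID WALK (core) — from a MID point along a 2-power isogeny

Lead star-p1 GEN 17.  Part 1 of 2 (part 2: Theorems/…StarOptBSFMidWalk, the (T2) door).  A «MID point» of a globally minimal `W₀/ℚ` (good ordinary at 2) is a
rational 2-torsion abscissa `m` that is RAMIFIED at 2 AND ODD.  THE WALK (adapted from `Walk.walk_aux` of line nsf): factor a 2-power isogeny `W₀ → V` as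
`λ ∘ [2^j]` with `W₀[2] ⊄ ker λ` and walk one rational 2-isogeny at a time (`Walk.twoIsogenyStep`), carrying a rational point `T` with `λ T ≠ O` and the
INVARIANT «`T` is ramified AND odd»: the next kernel `S ≠ T` is rational, and two distinct rational abscissae are never both ramified
(`TwoAdic.not_twoTorsionRamifiedAtTwo_and_rat`) nor both odd, so `S` is étale and even and by Greenberg's FLIP LAWS the dual point `π T` is again ramified and
odd; at the end `λ` is a change of variables `(±1, r ∈ ℤ, …)`.  So from a MID point `m` the walk reaches only curves with a ramified-and-odd rational abscissa —
unless it STARTS through `m` (`λ P_m = O`): then the partner `W₀/⟨P_m⟩` carries the étale-even dual point, and either the walk ends there or its next kernel is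
a SECOND rational abscissa of the partner, which on the explicit model `[0, −2a, 0, a² − 4b, 0]` (`2b = b₄ + m b₂ + 6m²`) makes `b` a rational square.

* `Walk.twoIsogenyStep_sq` — the 2-isogeny step through `(s, y)` with the extra clause «a second rational abscissa on the partner ⇒ `(b₄ + s b₂ + 6s²)/2 ∈ ℚ²`»;
* `midWalk_base`, `midWalk_aux` — the inductive walk with the invariant «ramified ∧ odd»;
* `exists_ramifiedOdd_or_etaleEven_of_midPoint` — from a MID point whose partner is not a centre, every curve 2-power-isogenous to `W₀` has a rational abscissa
  that is (ramified ∧ odd) or (étale ∧ even); `not_typeAB_of_midPoint` — hence none has a UNIQUE point of Greenberg type A xor B.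

Bookkeeping for an OPEN aside crux; fact-free; no `sorry`, no new definition; nothing here reads `r_an`; StarOptB / E1M / BSD are NOT proved.
-/

set_option linter.dupNamespace false
set_option autoImplicit false

noncomputable section

open scoped Classical

open WeierstrassCurve Literature.NumberTheory.EllipticCurves Literature.NumberTheory.EllipticCurves.Greenberg1999

namespace Summit.BirchSwinnertonDyer.BirchSwinnertonDyer.Theorems.DepletionAtTwo.Walk

/-! ### §1 The 2-isogeny step, with the «second rational abscissa ⇒ square» clause -/

section Step

variable (E : WeierstrassCurve ℚ) [E.IsElliptic] [E.IsGloballyMinimal]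

/-- **The `2`-isogeny step through `(s, y)`, with the centre clause.**  As `Walk.twoIsogenyStep` (globally minimal partner `E₁`, isogeny `π` with
kernel `{O, S}`, dual point `(s₁, y₁)`, flip laws), PLUS: if `E₁` has a rational 2-torsion abscissa `t ≠ s₁`, then `(b₄ + s b₂ + 6s²)/2` is a rational
square — on the model `E' = [0, −2a, 0, a² − 4b, 0]` of `E₁` (`[0, a, 0, b, 0]` the normal form of `(E, s)`, `2b = b₄ + s b₂ + 6s²`) the abscissa of the
transported point is a nonzero root of `x((x − a)² − 4b)`. [cite: SilvermanAEC2009, III.4 Example 4.5 and Cor. VIII.8.3] -/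
theorem twoIsogenyStep_sq {s y : ℚ} (hP : E.toAffine.Nonsingular s y) (hy : 2 * y + E.a₁ * s + E.a₃ = 0) :
    ∃ (E₁ : WeierstrassCurve ℚ) (_ : E₁.IsElliptic) (_ : E₁.IsGloballyMinimal) (π : Isogeny E E₁) (s₁ y₁ : ℚ)
      (hP₁ : E₁.toAffine.Nonsingular s₁ y₁),
      2 * y₁ + E₁.a₁ * s₁ + E₁.a₃ = 0 ∧
      (∀ Q : E.geomPoints, π Q = 0 ↔ Q = 0 ∨ Q = toGeomPoints E (Affine.Point.some s y hP)) ∧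
      (∀ T : E.geomPoints, T ≠ 0 → T + T = 0 → T ≠ toGeomPoints E (Affine.Point.some s y hP) →
        π T = toGeomPoints E₁ (Affine.Point.some s₁ y₁ hP₁)) ∧
      ((Rank1Residual.GoodOrd E 2 ∨ Rank1Residual.Mult E 2) → (Rank1Residual.GoodOrd E₁ 2 ∨ Rank1Residual.Mult E₁ 2) →
        (TwoTorsionRamifiedAtTwo s ↔ ¬ TwoTorsionRamifiedAtTwo s₁) ∧ (TwoTorsionOdd E s ↔ ¬ TwoTorsionOdd E₁ s₁)) ∧
      ((∃ t : ℚ, t ≠ s₁ ∧ HasRationalTwoTorsionX E₁ t) → IsSquare ((E.b₄ + s * E.b₂ + 6 * s ^ 2) / 2)) := by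
  set C : VariableChange ℚ := ⟨1, s, -E.a₁ / 2, y⟩ with hC
  haveI hNF : (C • E).IsTwoTorsionNF :=
    isTwoTorsionNF_smul_of_two_nsmul_eq_zero two_ne_zero hP (by rw [Affine.negY]; linear_combination hy)
  obtain ⟨D, hD⟩ := hasGlobalMinimalModel_rat_holds (C • E).twoIsogenyCodomain
  set E₁ : WeierstrassCurve ℚ := D • (C • E).twoIsogenyCodomain with hE₁
  haveI : E₁.IsGloballyMinimal := hD
  have hlink : D⁻¹ • E₁ = (C • E).twoIsogenyCodomain := inv_smul_smul D _
  haveI : (D⁻¹ • E₁).IsTwoTorsionNF := by rw [hlink]; infer_instance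
  have hE₁eq : E₁.toAffine.Equation (D⁻¹).r (D⁻¹).t := equation_r_t_of_isTwoTorsionNF_smul E₁ D⁻¹
  have hP₁ : E₁.toAffine.Nonsingular (D⁻¹).r (D⁻¹).t := Affine.equation_iff_nonsingular.mp hE₁eq
  have hy₁ : 2 * (D⁻¹).t + E₁.a₁ * (D⁻¹).r + E₁.a₃ = 0 := two_mul_t_add_eq_zero_of_isTwoTorsionNF_smul E₁ D⁻¹
  let π : Isogeny E E₁ :=
    (VariableChange.toIsogeny (C • E).twoIsogenyCodomain D).comp
      ((C • E).twoIsogeny.comp (VariableChange.toIsogeny E C))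
  have hT : VariableChange.toIsogeny E C (toGeomPoints E (Affine.Point.some s y hP)) = (C • E).geomTwoTorsionPoint :=
    toIsogeny_toGeomPoints_eq_geomTwoTorsionPoint E hP hy
  refine ⟨E₁, inferInstance, hD, π, (D⁻¹).r, (D⁻¹).t, hP₁, hy₁, fun Q ↦ ?_, fun T hT0 hT2 hTS ↦ ?_, fun hE hE₁ ↦ ?_, ?_⟩
  · -- kernel
    show VariableChange.toIsogeny _ D ((C • E).twoIsogeny (VariableChange.toIsogeny E C Q)) = 0 ↔ _
    rw [← map_zero (VariableChange.toIsogeny (C • E).twoIsogenyCodomain D),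
      (VariableChange.toIsogeny_injective _ D).eq_iff, twoIsogeny_apply, ← AddMonoidHom.mem_ker,
      mem_ker_twoIsogenyGeomHom_iff, ← hT, ← map_zero (VariableChange.toIsogeny E C),
      (VariableChange.toIsogeny_injective E C).eq_iff, (VariableChange.toIsogeny_injective E C).eq_iff]
  · -- the dual point
    show VariableChange.toIsogeny _ D ((C • E).twoIsogeny (VariableChange.toIsogeny E C T)) = _
    have h0' : VariableChange.toIsogeny E C T ≠ 0 := fun h ↦
      hT0 (VariableChange.toIsogeny_injective E C (h.trans (map_zero _).symm))
    have h2' : VariableChange.toIsogeny E C T + VariableChange.toIsogeny E C T = 0 := by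
      rw [← map_add, hT2, map_zero]
    have hT' : VariableChange.toIsogeny E C T ≠ (C • E).geomTwoTorsionPoint := fun h ↦
      hTS (VariableChange.toIsogeny_injective E C (h.trans hT.symm))
    rw [twoIsogeny_eq_geomTwoTorsionPoint (C • E) h0' h2' hT']
    exact toIsogeny_geomTwoTorsionPoint _ D hP₁
  · -- edge laws
    exact ramified_odd_dual_of_twoIsogeny_of_goodOrd_or_mult E E₁ C D⁻¹ hE hE₁ hlink
  · -- the centre clause
    rintro ⟨t, hts, ht⟩
    set a : ℚ := (C • E).a₂ with ha
    set b : ℚ := (C • E).a₄ with hb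
    have h2b : 2 * b = E.b₄ + s * E.b₂ + 6 * s ^ 2 := by
      have h := two_mul_a₄_of_isTwoTorsionNF_smul E C
      have hu : ((C.u⁻¹ : ℚˣ) : ℚ) = 1 := by simp [hC]
      rw [hu, one_pow, one_mul] at h
      exact h
    -- transport `t` to the codomain model
    have ht' : HasRationalTwoTorsionX (D⁻¹ • E₁) ((D⁻¹).toX t) := PrimeConductorTwoTorsion.hasRationalTwoTorsionX_smul E₁ D⁻¹ ht
    rw [hlink] at ht'
    have htX := VariableChange.toX_def D⁻¹ t
    have ht0 : (D⁻¹).toX t ≠ 0 := by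
      rw [htX]
      exact mul_ne_zero (pow_ne_zero _ (Units.ne_zero _)) (sub_ne_zero.mpr hts)
    obtain ⟨y', hEq', h2'⟩ := ht'
    have hcub := fourXCubed_add_eq_zero_of_twoTorsion hEq' h2'
    set z : ℚ := (D⁻¹).toX t with hz
    have hcod : (C • E).twoIsogenyCodomain = ⟨0, -2 * a, 0, a ^ 2 - 4 * b, 0⟩ := rfl
    rw [hcod] at hcub
    simp only [WeierstrassCurve.b₂, WeierstrassCurve.b₄, WeierstrassCurve.b₆] at hcub
    -- `4z³ − 8a z² + 4(a² − 4b) z = 0`, `z ≠ 0` ⇒ `(z − a)² = 4b`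
    have hq : (z - a) ^ 2 - 4 * b = 0 := by
      have h : z * ((z - a) ^ 2 - 4 * b) = 0 := by linear_combination hcub / 4
      exact (mul_eq_zero.mp h).resolve_left ht0
    refine ⟨(z - a) / 2, ?_⟩
    rw [← h2b]
    linear_combination hq / (-4)

end Step

end Summit.BirchSwinnertonDyer.BirchSwinnertonDyer.Theorems.DepletionAtTwo.Walk

namespace Summit.BirchSwinnertonDyer.BirchSwinnertonDyer.Theorems.DepletionAtTwo.MidWalk

open Summit.BirchSwinnertonDyer.BirchSwinnertonDyer.Theorems.DepletionAtTwo.Walk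

/-! ### §2 The inductive walk with the invariant «ramified AND odd» -/

/-- **Base**: an isogeny with trivial kernel between globally minimal curves is a change of variables `(±1, r ∈ ℤ, …)`, which carries a
ramified-and-odd rational abscissa `t` of `E` to one of `V`. [cite: SilvermanAEC2009, II.2.4.1 and Prop. VII.1.3(b)] -/
theorem midWalk_base {E V : WeierstrassCurve ℚ} [E.IsElliptic] [E.IsGloballyMinimal] [V.IsElliptic] [V.IsGloballyMinimal]
    (lam : Isogeny E V) (hker : ∀ P, lam P = 0 → P = 0) {t : ℚ} (ht : HasRationalTwoTorsionX E t)
    (hR : TwoTorsionRamifiedAtTwo t) (hO : TwoTorsionOdd E t) :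
    ∃ x₀ : ℚ, HasRationalTwoTorsionX V x₀ ∧ TwoTorsionRamifiedAtTwo x₀ ∧ TwoTorsionOdd V x₀ := by
  have hdeg : lam.degree = 1 := by
    unfold Isogeny.degree
    have hbot : lam.toAddMonoidHom.ker = ⊥ := (AddMonoidHom.ker_eq_bot_iff _).mpr fun P Q h ↦ by
      have h0 : lam (P - Q) = 0 := by rw [map_sub]; exact sub_eq_zero.mpr h
      exact sub_eq_zero.mp (hker _ h0)
    rw [hbot, AddSubgroup.card_bot]
  obtain ⟨C, hC⟩ := lam.exists_variableChange_eq_of_degree_eq_one hdeg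
  subst hC
  obtain ⟨hu, r, s₀, t₀, hr, -, -⟩ := isGloballyMinimal_unique_holds E C
  have hu2 : ((C.u⁻¹ : ℚˣ) : ℚ) ^ 2 = 1 := by
    rcases hu with h | h <;> simp [h]
  have hx₀ : C.toX t = t + ((-r : ℤ) : ℚ) := by
    rw [VariableChange.toX_def, hu2, one_mul, hr]; push_cast; ring
  have hrat : HasRationalTwoTorsionX (C • E) (C.toX t) := PrimeConductorTwoTorsion.hasRationalTwoTorsionX_smul E C ht
  refine ⟨C.toX t, hrat, ?_, ?_⟩
  · rw [TwoTorsionRamifiedAtTwo, hx₀, padicValRat_add_intCast_neg_iff]; exact hR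
  · rw [twoTorsionOdd_smul_iff, ← VariableChange.ofX_def, VariableChange.ofX_toX]; exact hO

/-- **The MID walk.**  For globally minimal elliptic `E` (good ordinary at `2`) and `V` over `ℚ`, an isogeny `λ : E → V` whose kernel is killed by `2^k`, and a
rational point `T = (t, y)` of order `2` on `E` with `λ T ≠ O` whose abscissa is ramified at `2` AND odd: `V` has a rational 2-torsion abscissa that is ramified
and odd.  Induction on `k` as in `Walk.walk_aux`: the next kernel `S ≠ T` is rational, not ramified (two distinct rational abscissae are not both ramified) and not
odd (nor both least), so by the flip laws the dual point `π T` is ramified and odd. [cite: GreenbergLNM1716, §5; SilvermanAEC2009, III.4.11] -/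
theorem midWalk_aux (k : ℕ) :
    ∀ (E : WeierstrassCurve ℚ) [E.IsElliptic] [E.IsGloballyMinimal] (V : WeierstrassCurve ℚ) [V.IsElliptic]
      [V.IsGloballyMinimal] (lam : Isogeny E V) (t y : ℚ) (hP : E.toAffine.Nonsingular t y),
      2 * y + E.a₁ * t + E.a₃ = 0 → IsOrdinaryAt E 2 →
      (∀ P : E.geomPoints, lam P = 0 → (2 ^ k : ℕ) • P = 0) →
      lam (toGeomPoints E (Affine.Point.some t y hP)) ≠ 0 →
      TwoTorsionRamifiedAtTwo t → TwoTorsionOdd E t →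
      ∃ x₀ : ℚ, HasRationalTwoTorsionX V x₀ ∧ TwoTorsionRamifiedAtTwo x₀ ∧ TwoTorsionOdd V x₀ := by
  induction k with
  | zero =>
    intro E _ _ V _ _ lam t y hP hy hord hk hT hR hO
    exact midWalk_base lam (fun P h ↦ by simpa using hk P h) (hasRationalTwoTorsionX_of_nonsingular hP hy) hR hO
  | succ k ih =>
    intro E _ _ V _ _ lam t y hP hy hord hk hT hRt hOt
    by_cases hsmall : ∀ P : E.geomPoints, lam P = 0 → (2 ^ k : ℕ) • P = 0
    · exact ih E V lam t y hP hy hord hsmall hT hRt hOt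
    push Not at hsmall
    obtain ⟨P, hPker, hPk⟩ := hsmall
    set S : E.geomPoints := (2 ^ k : ℕ) • P with hSdef
    have hS0 : S ≠ 0 := hPk
    have hS2 : S + S = 0 := by
      rw [hSdef, ← two_nsmul, ← mul_nsmul, ← pow_succ]
      exact hk P hPker
    have hlamS : lam S = 0 := by rw [hSdef, map_nsmul, hPker, nsmul_zero]
    set T : E.geomPoints := toGeomPoints E (Affine.Point.some t y hP) with hTdef
    obtain ⟨hT0, hT2, hTfix⟩ := toGeomPoints_two_torsion hP hy
    have hSfix : ∀ σ : Field.absoluteGaloisGroup ℚ, σ • S = S := by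
      intro σ
      have hσ2 : σ • S + σ • S = 0 := by rw [← smul_add, hS2, smul_zero]
      have hσlam : lam (σ • S) = 0 := by rw [lam.map_smul, hlamS, smul_zero]
      rcases eq_zero_or_eq_of_ker lam hS2 hT2 hσ2 hS0 hT0 hlamS hT hσlam with h | h
      · exact absurd (MulAction.injective σ (h.trans (smul_zero σ).symm)) hS0
      · exact h
    obtain ⟨s, ys, hPs, hSeq, hys⟩ := exists_eq_toGeomPoints_of_two_torsion (E := E) hS0 hS2 hSfix
    have hs : HasRationalTwoTorsionX E s := hasRationalTwoTorsionX_of_nonsingular hPs hys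
    have ht : HasRationalTwoTorsionX E t := hasRationalTwoTorsionX_of_nonsingular hP hy
    have hst : s ≠ t := by
      intro h
      have : S = T := by rw [hSeq, hTdef, toGeomPoints_some_eq_iff hPs hP hys hy]; exact h
      exact hT (this ▸ hlamS)
    -- `S` is étale and even
    have hSnR : ¬ TwoTorsionRamifiedAtTwo s := fun hsr ↦
      TwoAdic.not_twoTorsionRamifiedAtTwo_and_rat E hord.1 ht hs hst.symm ⟨hRt, hsr⟩
    have hSnO : ¬ TwoTorsionOdd E s := fun hso ↦ hst (eq_of_twoTorsionOdd_of_twoTorsionOdd hs ht hso hOt)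
    -- the step through `S`
    obtain ⟨E₁, hE₁, hE₁min, π, s₁, y₁, hP₁, hy₁, hkerπ, hdual, hedge⟩ := twoIsogenyStep E hPs hys
    have hord₁ : IsOrdinaryAt E₁ 2 := IsogenyMuShift.isOrdinaryAt_of_isIsogenous ⟨π⟩ hord
    obtain ⟨hR, hO⟩ := hedge (Or.inl hord) (Or.inl hord₁)
    have hR₁ : TwoTorsionRamifiedAtTwo s₁ := by
      by_contra h; exact hSnR (hR.mpr h)
    have hO₁ : TwoTorsionOdd E₁ s₁ := by
      by_contra h; exact hSnO (hO.mpr h)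
    -- factor `λ = λ₁ ∘ π`
    have hsep : π.deg ≤ Nat.card π.toAddMonoidHom.ker := le_of_eq (Isogeny.degree_eq_deg π).symm
    have hkerle : ∀ Q : E.geomPoints, π Q = 0 → lam Q = 0 := by
      intro Q hQ
      rcases (hkerπ Q).mp hQ with h | h
      · rw [h, map_zero]
      · rw [h, ← hSeq, hlamS]
    obtain ⟨lam₁, hlam₁⟩ := π.exists_eq_comp_of_ker_le lam hsep hkerle
    have hTS : T ≠ toGeomPoints E (Affine.Point.some s ys hPs) := fun h ↦ hT (by rw [hTdef] at h ⊢; rw [h, ← hSeq, hlamS])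
    have hπT : π T = toGeomPoints E₁ (Affine.Point.some s₁ y₁ hP₁) := hdual T hT0 hT2 hTS
    have hT₁ : lam₁ (toGeomPoints E₁ (Affine.Point.some s₁ y₁ hP₁)) ≠ 0 := by
      rw [← hπT, ← hlam₁]; exact hT
    have hk₁ : ∀ Q : E₁.geomPoints, lam₁ Q = 0 → (2 ^ k : ℕ) • Q = 0 := by
      intro Q hQ
      obtain ⟨R, rfl⟩ := π.surjective Q
      have hRlam0 : lam R = 0 := by rw [hlam₁]; exact hQ
      have hR2 : (2 ^ k : ℕ) • R + (2 ^ k : ℕ) • R = 0 := by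
        rw [← two_nsmul, ← mul_nsmul, ← pow_succ]
        exact hk R hRlam0
      have hRlam : lam ((2 ^ k : ℕ) • R) = 0 := by rw [map_nsmul, hRlam0, nsmul_zero]
      rw [← map_nsmul]
      rcases eq_zero_or_eq_of_ker lam hS2 hT2 hR2 hS0 hT0 hlamS hT hRlam with h | h
      · rw [h, map_zero]
      · rw [h]
        exact (hkerπ S).mpr (Or.inr hSeq)
    haveI := hE₁
    haveI := hE₁min
    exact ih E₁ V lam₁ s₁ y₁ hP₁ hy₁ hord₁ hk₁ hT₁ hR₁ hO₁

/-! ### §3 Starting the walk at a MID point -/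

/-- In a `2^k`-torsion group of geometric points, a nonzero element has a multiple of exact order `2`. [folklore] -/
theorem exists_order_two_multiple {E : WeierstrassCurve ℚ} (k : ℕ) :
    ∀ (Q : E.geomPoints), Q ≠ 0 → (2 ^ k : ℕ) • Q = 0 → ∃ j : ℕ, (2 ^ j : ℕ) • Q ≠ 0 ∧ (2 ^ j : ℕ) • Q + (2 ^ j : ℕ) • Q = 0 := by
  induction k with
  | zero =>
    intro Q hQ0 hQk
    rw [pow_zero, one_nsmul] at hQk
    exact absurd hQk hQ0
  | succ k ih =>
    intro Q hQ0 hQk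
    by_cases h : (2 ^ k : ℕ) • Q = 0
    · exact ih Q hQ0 h
    · refine ⟨k, h, ?_⟩
      rw [← two_nsmul, ← mul_nsmul, ← pow_succ]
      exact hQk

/-- **From a MID point along a 2-power isogeny.**  `W₀` globally minimal, good ordinary at 2, with a rational abscissa `m` that is RAMIFIED AND ODD whose
2-isogenous partner is NOT a centre (`(b₄ + m b₂ + 6m²)/2 ∉ ℚ²`); `V` globally minimal, `φ : W₀ → V` of degree `2^k`.  Then `V` has a rational 2-torsion
abscissa that is either (ramified ∧ odd) or (étale ∧ even) — in particular never a UNIQUE point of type A xor B.  Proof: `φ = λ ∘ [2^j]`, `W₀[2] ⊄ ker λ`;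
if `λ P_m ≠ O` run `midWalk_aux` from `P_m`; else the first step goes through `m` (`Walk.twoIsogenyStep_sq`), the dual point `s₁` is étale and even with
`λ₁ S₁ ≠ O`; if `ker λ₁ = O` transport `s₁` to `V` (`(±1, r ∈ ℤ)`), otherwise `ker λ₁` contains a rational point of order 2 distinct from `S₁`, a second
rational abscissa of the partner — excluded. [cite: GreenbergLNM1716, §5; SilvermanAEC2009, III.4.11 and III.4.12] -/
theorem exists_ramifiedOdd_or_etaleEven_of_midPoint
    (W₀ : WeierstrassCurve ℚ) [W₀.IsElliptic] [W₀.IsGloballyMinimal] (hord : IsOrdinaryAt W₀ 2)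
    {m : ℚ} (hm : HasRationalTwoTorsionX W₀ m) (hRm : TwoTorsionRamifiedAtTwo m) (hOm : TwoTorsionOdd W₀ m)
    (hnsq : ¬ IsSquare ((W₀.b₄ + m * W₀.b₂ + 6 * m ^ 2) / 2))
    (V : WeierstrassCurve ℚ) [V.IsElliptic] [V.IsGloballyMinimal] (φ : Isogeny W₀ V) (hk : ∃ k : ℕ, φ.degree = 2 ^ k) :
    ∃ x₀ : ℚ, HasRationalTwoTorsionX V x₀ ∧
      ((TwoTorsionRamifiedAtTwo x₀ ∧ TwoTorsionOdd V x₀) ∨ (¬ TwoTorsionRamifiedAtTwo x₀ ∧ ¬ TwoTorsionOdd V x₀)) := by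
  obtain ⟨k, hk⟩ := hk
  obtain ⟨ym, hPm, hym⟩ := exists_nonsingular_of_hasRationalTwoTorsionX W₀ hm
  obtain ⟨hM0, hM2, hMfix⟩ := toGeomPoints_two_torsion hPm hym
  set M : W₀.geomPoints := toGeomPoints W₀ (Affine.Point.some m ym hPm) with hMdef
  -- `φ = λ ∘ [2^j]`, `W₀[2] ⊄ ker λ`
  obtain ⟨j, lam, hlam, P₀, hP₀2, hlamP₀⟩ := exists_eq_comp_twoPow_nsmul φ
  have hkφ := twoPow_nsmul_eq_zero_of_degree φ hk
  have hklam : ∀ Q : W₀.geomPoints, lam Q = 0 → (2 ^ k : ℕ) • Q = 0 := by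
    intro Q hQ
    obtain ⟨R, hR⟩ := (Isogeny.nsmul W₀ (2 ^ j) (pow_ne_zero j two_ne_zero)).surjective Q
    rw [Isogeny.nsmul_apply] at hR
    subst hR
    have hφR : φ R = 0 := by rw [hlam]; exact hQ
    rw [← mul_nsmul', mul_comm, mul_nsmul', hkφ R hφR, nsmul_zero]
  by_cases hlamM : lam M = 0
  swap
  · -- the walk from `P_m` itself
    obtain ⟨x₀, hx₀, hR₀, hO₀⟩ := midWalk_aux k W₀ V lam m ym hPm hym hord hklam hlamM hRm hOm
    exact ⟨x₀, hx₀, Or.inl ⟨hR₀, hO₀⟩⟩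
  -- first edge through `m`
  obtain ⟨E₁, hE₁, hE₁min, π, s₁, y₁, hP₁, hy₁, hkerπ, hdual, hedge, hcentre⟩ := twoIsogenyStep_sq W₀ hPm hym
  haveI := hE₁
  haveI := hE₁min
  have hord₁ : IsOrdinaryAt E₁ 2 := IsogenyMuShift.isOrdinaryAt_of_isIsogenous ⟨π⟩ hord
  obtain ⟨hRflip, hOflip⟩ := hedge (Or.inl hord) (Or.inl hord₁)
  have hnR₁ : ¬ TwoTorsionRamifiedAtTwo s₁ := hRflip.mp hRm
  have hnO₁ : ¬ TwoTorsionOdd E₁ s₁ := hOflip.mp hOm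
  have hsep : π.deg ≤ Nat.card π.toAddMonoidHom.ker := le_of_eq (Isogeny.degree_eq_deg π).symm
  have hkerle : ∀ Q : W₀.geomPoints, π Q = 0 → lam Q = 0 := by
    intro Q hQ
    rcases (hkerπ Q).mp hQ with h | h
    · rw [h, map_zero]
    · rw [h]; exact hlamM
  obtain ⟨lam₁, hlam₁⟩ := π.exists_eq_comp_of_ker_le lam hsep hkerle
  have hP₀0 : P₀ ≠ 0 := fun h ↦ hlamP₀ (by rw [h, map_zero])
  have hP₀M : P₀ ≠ M := fun h ↦ hlamP₀ (by rw [h]; exact hlamM)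
  set T₁ : E₁.geomPoints := toGeomPoints E₁ (Affine.Point.some s₁ y₁ hP₁) with hT₁def
  have hπP₀ : π P₀ = T₁ := hdual P₀ hP₀0 hP₀2 hP₀M
  have hT₁ : lam₁ T₁ ≠ 0 := by rw [← hπP₀, ← hlam₁]; exact hlamP₀
  obtain ⟨hT₁0, hT₁2, -⟩ := toGeomPoints_two_torsion hP₁ hy₁
  have hs₁ : HasRationalTwoTorsionX E₁ s₁ := hasRationalTwoTorsionX_of_nonsingular hP₁ hy₁
  have hk₁ : ∀ Q : E₁.geomPoints, lam₁ Q = 0 → (2 ^ k : ℕ) • Q = 0 := by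
    intro Q hQ
    obtain ⟨R, rfl⟩ := π.surjective Q
    have hR : lam R = 0 := by rw [hlam₁]; exact hQ
    rw [← map_nsmul, hklam R hR, map_zero]
  by_cases htriv : ∀ Q : E₁.geomPoints, lam₁ Q = 0 → Q = 0
  · -- the walk ends at the partner: transport the étale-even point `s₁` to `V`
    have hdeg : lam₁.degree = 1 := by
      unfold Isogeny.degree
      have hbot : lam₁.toAddMonoidHom.ker = ⊥ := (AddMonoidHom.ker_eq_bot_iff _).mpr fun P Q h ↦ by
        have h0 : lam₁ (P - Q) = 0 := by rw [map_sub]; exact sub_eq_zero.mpr h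
        exact sub_eq_zero.mp (htriv _ h0)
      rw [hbot, AddSubgroup.card_bot]
    obtain ⟨C, hC⟩ := lam₁.exists_variableChange_eq_of_degree_eq_one hdeg
    subst hC
    obtain ⟨hu, r, s₀, t₀, hr, -, -⟩ := isGloballyMinimal_unique_holds E₁ C
    have hu2 : ((C.u⁻¹ : ℚˣ) : ℚ) ^ 2 = 1 := by
      rcases hu with h | h <;> simp [h]
    have hx₀ : C.toX s₁ = s₁ + ((-r : ℤ) : ℚ) := by
      rw [VariableChange.toX_def, hu2, one_mul, hr]; push_cast; ring
    have hrat : HasRationalTwoTorsionX (C • E₁) (C.toX s₁) := PrimeConductorTwoTorsion.hasRationalTwoTorsionX_smul E₁ C hs₁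
    refine ⟨C.toX s₁, hrat, Or.inr ⟨?_, ?_⟩⟩
    · rw [TwoTorsionRamifiedAtTwo, hx₀, padicValRat_add_intCast_neg_iff]; exact hnR₁
    · rw [twoTorsionOdd_smul_iff, ← VariableChange.ofX_def, VariableChange.ofX_toX]; exact hnO₁
  · -- a second rational 2-torsion point on the partner: excluded by `hnsq`
    exfalso
    push Not at htriv
    obtain ⟨Q, hQker, hQ0⟩ := htriv
    obtain ⟨i, hS0, hS2⟩ := exists_order_two_multiple k Q hQ0 (hk₁ Q hQker)
    set S : E₁.geomPoints := (2 ^ i : ℕ) • Q with hSdef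
    have hlamS : lam₁ S = 0 := by rw [hSdef, map_nsmul, hQker, nsmul_zero]
    have hSfix : ∀ σ : Field.absoluteGaloisGroup ℚ, σ • S = S := by
      intro σ
      have hσ2 : σ • S + σ • S = 0 := by rw [← smul_add, hS2, smul_zero]
      have hσlam : lam₁ (σ • S) = 0 := by rw [lam₁.map_smul, hlamS, smul_zero]
      rcases eq_zero_or_eq_of_ker lam₁ hS2 hT₁2 hσ2 hS0 hT₁0 hlamS hT₁ hσlam with h | h
      · exact absurd (MulAction.injective σ (h.trans (smul_zero σ).symm)) hS0
      · exact h
    obtain ⟨s₂, y₂, hP₂, hSeq, hy₂⟩ := exists_eq_toGeomPoints_of_two_torsion (E := E₁) hS0 hS2 hSfix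
    have hs₂ : HasRationalTwoTorsionX E₁ s₂ := hasRationalTwoTorsionX_of_nonsingular hP₂ hy₂
    have hne : s₂ ≠ s₁ := by
      intro h
      have : S = T₁ := by rw [hSeq, hT₁def, toGeomPoints_some_eq_iff hP₂ hP₁ hy₂ hy₁]; exact h
      exact hT₁ (this ▸ hlamS)
    exact hnsq (hcentre ⟨s₂, hne, hs₂⟩)

/-- **No habitat-type curve in the 2-power class of a MID point whose partner is not a centre.**  With `W₀`, `m`, `V`, `φ` as in
`exists_ramifiedOdd_or_etaleEven_of_midPoint`: `V` has no UNIQUE rational 2-torsion abscissa of Greenberg type A xor B.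
[cite: GreenbergLNM1716, §5 Props. 5.13–5.14 (pp. 120–121)] -/
theorem not_typeAB_of_midPoint
    (W₀ : WeierstrassCurve ℚ) [W₀.IsElliptic] [W₀.IsGloballyMinimal] (hord : IsOrdinaryAt W₀ 2)
    {m : ℚ} (hm : HasRationalTwoTorsionX W₀ m) (hRm : TwoTorsionRamifiedAtTwo m) (hOm : TwoTorsionOdd W₀ m)
    (hnsq : ¬ IsSquare ((W₀.b₄ + m * W₀.b₂ + 6 * m ^ 2) / 2))
    (V : WeierstrassCurve ℚ) [V.IsElliptic] [V.IsGloballyMinimal] (φ : Isogeny W₀ V) (hk : ∃ k : ℕ, φ.degree = 2 ^ k)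
    {xV : ℚ} (huV : HasUniqueRationalTwoTorsionX V xV) :
    ¬ ((TwoTorsionRamifiedAtTwo xV ∧ ¬ TwoTorsionOdd V xV) ∨ (TwoTorsionOdd V xV ∧ ¬ TwoTorsionRamifiedAtTwo xV)) := by
  obtain ⟨x₀, hx₀, hbits⟩ := exists_ramifiedOdd_or_etaleEven_of_midPoint W₀ hord hm hRm hOm hnsq V φ hk
  have hx : x₀ = xV := huV.2 x₀ hx₀
  subst hx
  rintro (⟨hR, hnO⟩ | ⟨hO, hnR⟩)
  · rcases hbits with ⟨-, hO⟩ | ⟨hnR', -⟩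
    · exact hnO hO
    · exact hnR' hR
  · rcases hbits with ⟨hR, -⟩ | ⟨-, hnO'⟩
    · exact hnR hR
    · exact hnO' hO

end Summit.BirchSwinnertonDyer.BirchSwinnertonDyer.Theorems.DepletionAtTwo.MidWalk

end
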